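import Summits.ValiantsHypothesis.ValiantsHypothesis.Theses.DefinabilityGap
import Literature.Computability.AlgebraicComplexity.BLMW11WeakValiantHypothesis
import HarnessLib

/-!
# Route `DefinabilityGap` — the collapse piece `CollapseToVPws` is a BARE RESIDUAL (kernel certificate)

Census instrument of the decomp-valiant workshop (seat `decomp-val-census-1`, generation 18), supporting the
crux item `CollapseToVPws` (stmt-ValiantsHypothesis-23702, the «ws-square» child of `Theses/DefinabilityGap.lean`)
WITHOUT closing it: it certifies the census classification «BARE·THEOREM» of `census/BARE-LOCATOR-v1` for the
ROUTE DECL itself (the bundled class form `VP = VNP → VP ⊆ VP_ws` is `collapseToVPws_iff_residual` of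
`Theorems/BareResidualCriterion.lean`; here the unbundled route statement is treated directly).

`CollapseToVPws` says: if `VP_ℂ = VNP_ℂ` then every `VNP` family has p-bounded weakly-skew (= determinantal)
complexity (`IsVPwsFamily`).  Since `VP_ws` is closed under p-projections (`IsVPwsFamily.of_isPProjection`,
[BLMW 2011, §9.3]) and the permanent is `VNP`-complete (`isVNPComplete_perPoly_holds`, Valiant 1979), the
class-form consequent is equivalent to `(per_m) ∈ VP_ws`, and contraposition shows that the piece is LITERALLY
«`(per_m) ∉ VP_ws` ⟹ `VP_ℂ ≠ VNP_ℂ`», i.e. the classical bridge from Valiant's Conjecture 1.1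
(`DcPerSuperpolynomial ℂ`: `dc(per_m)` is not polynomially bounded) to the summit.  Nothing here proves either
side; `VP ≠ VNP` is untouched (LADDER-Valiant rung 0).

* `vnp_subset_vpws_of_isVPwsFamily_perPoly`, `isVPwsFamily_perPoly_of_vnp_subset_vpws` : the
  VNP-completeness step for `VP_ws` (the `\overline{VP_ws}` analogue is BLMW 2011 Prop. 9.3.2 in the tree);
* `collapseToVPws_iff_perMem`   : `CollapseToVPws ↔ (VP_ℂ = VNP_ℂ → (per_m) ∈ VP_ws)`;
* `collapseToVPws_iff_residual` : `CollapseToVPws ↔ ((per_m) ∉ VP_ws → ValiantsHypothesis)`;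
* `collapseToVPws_iff_dc`       : `CollapseToVPws ↔ (DcPerSuperpolynomial ℂ → ValiantsHypothesis)`;
* `collapseToVPws_of_vh`         : the piece is implied by the summit (vacuous under `S`).

References: [BurgisserEtAl2011] Bürgisser–Landsberg–Manivel–Weyman, SIAM J. Comput. 40 (2011), §9.3;
[Valiant1979] L. Valiant, *Completeness classes in algebra*, STOC 1979; [Burgisser2000] P. Bürgisser,
*Completeness and Reduction in Algebraic Complexity Theory*, Conj. 1.1 / Thm. 2.10.
-/

-- layout Summits/ValiantsHypothesis/ValiantsHypothesis forces the duplicated namespace component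
set_option linter.dupNamespace false

namespace Summit.ValiantsHypothesis.ValiantsHypothesis.Theorems.DefinabilityGapCollapseToVPwsBare

open MvPolynomial Literature.Computability.AlgebraicComplexity
open Summit.ValiantsHypothesis.ValiantsHypothesis.Theses.DefinabilityGap (CollapseToVPws)

/-- **`(per_m) ∈ VP_ws` ⇒ `VNP ⊆ VP_ws`**: every `VNP` family is a p-projection of the permanent
(`isVNPComplete_perPoly_holds ℂ`, Valiant 1979) and `VP_ws` is closed under p-projections
(`IsVPwsFamily.of_isPProjection`, BLMW 2011 §9.3). [cite: BurgisserEtAl2011, §9.3] [cite: Valiant1979, Thm. 1] -/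
theorem vnp_subset_vpws_of_isVPwsFamily_perPoly
    (hper : IsVPwsFamily (fun m => perPoly (Fin m) ℂ))
    (v : ℕ → ℕ) (f : ∀ n, MvPolynomial (Fin (v n)) ℂ) (hf : IsVNPFamily f) :
    IsVPwsFamily f := by
  have hchar : ringChar ℂ ≠ 2 := by rw [ringChar.eq_zero]; norm_num
  exact hper.of_isPProjection (((isVNPComplete_perPoly_holds ℂ) hchar).2 v f hf)

/-- **`VNP ⊆ VP_ws` ⇒ `(per_m) ∈ VP_ws`**: the permanent family renamed to the variables `Fin (m·m)` is a
`VNP` family (`isVNPFamily_perPoly_holds`, `isVNPFamily_renameEquiv_iff`), and `per_m` is a projection of its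
renamed copy (`isProjection_rename` along the inverse bijection), so `VP_ws` membership transfers back
(`IsVPwsFamily.of_isPProjection` with the identity index map). [cite: BurgisserEtAl2011, §9.3] [cite: Burgisser2000, Rem. 2.2] -/
theorem isVPwsFamily_perPoly_of_vnp_subset_vpws
    (H : ∀ (v : ℕ → ℕ) (f : ∀ n, MvPolynomial (Fin (v n)) ℂ), IsVNPFamily f → IsVPwsFamily f) :
    IsVPwsFamily (fun m => perPoly (Fin m) ℂ) := by
  have hvnp : IsVNPFamily (fun n => rename (finProdFinEquiv (m := n) (n := n))
      (perPoly (Fin n) ℂ)) := by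
    have h := (isVNPFamily_renameEquiv_iff (σ := fun n => Fin n × Fin n)
      (fun n => finProdFinEquiv (m := n) (n := n)) (fun n => perPoly (Fin n) ℂ)).2
      (isVNPFamily_perPoly_holds ℂ)
    simpa only [renameEquiv_apply] using h
  have hws := H (fun n => n * n) _ hvnp
  refine hws.of_isPProjection ⟨fun n => n, IsPBounded.id, fun n => ?_⟩
  have h := isProjection_rename (finProdFinEquiv (m := n) (n := n)).symm
    (rename (finProdFinEquiv (m := n) (n := n)) (perPoly (Fin n) ℂ))
  rwa [rename_rename, Equiv.symm_comp_self, rename_id] at h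

/-- **Single-family form**: `CollapseToVPws ↔ (VP_ℂ = VNP_ℂ → (per_m) ∈ VP_ws)`.
[cite: BurgisserEtAl2011, §9.3] -/
theorem collapseToVPws_iff_perMem :
    CollapseToVPws ↔ (VP ℂ = VNP ℂ → IsVPwsFamily (fun m => perPoly (Fin m) ℂ)) := by
  unfold CollapseToVPws
  constructor
  · intro h hEq
    exact isVPwsFamily_perPoly_of_vnp_subset_vpws (h hEq)
  · intro h hEq v f hf
    exact vnp_subset_vpws_of_isVPwsFamily_perPoly (h hEq) v f hf

/-- **`CollapseToVPws` is the bare residual of `(per_m) ∉ VP_ws`**: the route's collapse piece is equivalent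
to the implication «`(per_m) ∉ VP_ws` ⟹ `ValiantsHypothesis`» (the census BARE-RESIDUAL TEST instance for item
23702; the bundled class form is `BareResidual.collapseToVPws_iff_residual`). [cite: Burgisser2000, Thm. 2.10] -/
theorem collapseToVPws_iff_residual :
    CollapseToVPws ↔ (¬ IsVPwsFamily (fun m => perPoly (Fin m) ℂ) → _root_.ValiantsHypothesis) := by
  rw [collapseToVPws_iff_perMem]
  change _ ↔ (¬ IsVPwsFamily (fun m => perPoly (Fin m) ℂ) → VP ℂ ≠ VNP ℂ)
  constructor
  · intro h hper hEq
    exact hper (h hEq)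
  · intro h hEq
    by_contra hper
    exact h hper hEq

/-- **Valiant form**: `CollapseToVPws ↔ (DcPerSuperpolynomial ℂ → ValiantsHypothesis)` — the piece is exactly
the bridge from Valiant's Conjecture 1.1 (`dc(per_m)` not polynomially bounded; tree
`dcPerSuperpolynomial_iff_not_isVPwsFamily_perPoly`) to the summit. [cite: Burgisser2000, Conj. 1.1] -/
theorem collapseToVPws_iff_dc :
    CollapseToVPws ↔ (DcPerSuperpolynomial ℂ → _root_.ValiantsHypothesis) := by
  rw [collapseToVPws_iff_residual, dcPerSuperpolynomial_iff_not_isVPwsFamily_perPoly]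

/-- **Necessity (vacuity under the summit)**: `ValiantsHypothesis → CollapseToVPws`. [folklore] -/
theorem collapseToVPws_of_vh (h : _root_.ValiantsHypothesis) : CollapseToVPws :=
  collapseToVPws_iff_residual.2 fun _ => h

end Summit.ValiantsHypothesis.ValiantsHypothesis.Theorems.DefinabilityGapCollapseToVPwsBare
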